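import Literature.IUT.HodgeTheaters.DiscreteProfiniteConjugates
import Literature.Topology.FourManifolds.GroupTrisections
import Mathlib.Logic.Equiv.Prod
import HarnessLib

/-!
# The two surface-group presentations of the tree agree

Topic `Literature/IUT/HodgeTheaters`; theorems only.  `Literature.IUT.HodgeTheaters.SurfaceGroup g`
([IUTchI] Thm 2.6, generators `Fin g ⊕ Fin g`, abc-iut-L5-t1) and
`Literature.Topology.FourManifolds.SurfaceGroup g` (generators `surfaceGen g = Fin g × Bool`) are the
same one-relator group `⟨a₁, b₁, …, a_g, b_g ∣ ∏ [aᵢ, bᵢ]⟩`: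

* `freeGroupCongr_surfaceRelator` — the relabelling `inl i ↦ (i, false) = aᵢ`, `inr i ↦ (i, true) = bᵢ`
  carries one surface relator to the other;
* `exists_mulEquiv_surfaceGroup` — hence `SurfaceGroup g ≃* FourManifolds.SurfaceGroup g`
  (`PresentedGroup.equivPresentedGroup`).

This is the bridge through which the surface-group halves of [IUTchI] Lem. 2.7 (proved over the
`FourManifolds` presentation in `Literature/GroupTheory/CombinatorialGroupTheory`) are transported to
the typed statements of `DiscreteProfiniteConjugates.lean`.

## References

* S. Mochizuki, *Inter-universal Teichmüller Theory I*, PRIMS 57 (2021), Thm. 2.6 (p. 56).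
  [Mochizuki2012]
-/

noncomputable section

namespace Literature.IUT.HodgeTheaters

universe u

/-- The relabelling `Fin g ⊕ Fin g ≃ Fin g × Bool`, `inl i ↦ (i, false)`, `inr i ↦ (i, true)`,
carries the surface relator of `DiscreteProfiniteConjugates.lean` to that of
`FourManifolds.GroupTrisections`. [cite: Mochizuki2012, Thm 2.6 p.56] -/
theorem freeGroupCongr_surfaceRelator (g : ℕ) :
    FreeGroup.freeGroupCongr ((Equiv.boolProdEquivSum (Fin g)).symm.trans (Equiv.prodComm Bool (Fin g)))
        (surfaceRelator g) = Literature.Topology.FourManifolds.surfaceRelator g := by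
  rw [surfaceRelator, Literature.Topology.FourManifolds.surfaceRelator, map_list_prod, List.map_map]
  refine congrArg List.prod (List.map_congr_left fun i _ => ?_)
  simp only [Function.comp_apply, map_mul, map_inv, FreeGroup.freeGroupCongr_apply, FreeGroup.map.of,
    Equiv.trans_apply, Equiv.prodComm_apply, Literature.Topology.FourManifolds.genA,
    Literature.Topology.FourManifolds.genB]
  rfl

/-- **The two surface-group presentations of the tree are isomorphic**:
`⟨a₁,b₁,…,a_g,b_g ∣ ∏[aᵢ,bᵢ]⟩` on `Fin g ⊕ Fin g` and on `Fin g × Bool`.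
[cite: Mochizuki2012, Thm 2.6 p.56] -/
theorem exists_mulEquiv_surfaceGroup (g : ℕ) :
    Nonempty (SurfaceGroup g ≃* Literature.Topology.FourManifolds.SurfaceGroup g) := by
  have h := freeGroupCongr_surfaceRelator g
  have hs : FreeGroup.freeGroupCongr ((Equiv.boolProdEquivSum (Fin g)).symm.trans
      (Equiv.prodComm Bool (Fin g))) '' ({surfaceRelator g} : Set (FreeGroup (Fin g ⊕ Fin g))) =
      {Literature.Topology.FourManifolds.surfaceRelator g} := by
    rw [Set.image_singleton, h]
  have e := PresentedGroup.equivPresentedGroup ({surfaceRelator g} : Set (FreeGroup (Fin g ⊕ Fin g)))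
    ((Equiv.boolProdEquivSum (Fin g)).symm.trans (Equiv.prodComm Bool (Fin g)))
  rw [hs] at e
  exact ⟨e⟩

end Literature.IUT.HodgeTheaters
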